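import Literature.AlgebraicGeometry.HodgeTheory.WeilClassesFourfoldsProofs
import Literature.AlgebraicGeometry.HodgeTheory.AbelianVarietyEndomorphismsHOne
import Literature.AlgebraicGeometry.HodgeTheory.ComplexBettiKunneth
import Literature.AlgebraicTopology.SingularHomology.CupProductExteriorH1
import Literature.AlgebraicGeometry.Motives.AbelianVarietyProjectiveChart
import HarnessLib

/-!
# Crux `HeckePrymAnchors` (stmt-HodgeConjecture-14496), line `Sketch` · stub A2 `stub_surfaceProductStep`,
# conditional on the named fact `Motives.abelianVarietyCohomologyExteriorH1`

Route `HeckePrymWeil`. ONE PRODUCT STEP in the anchor direction: for a prime `p` and complex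
abelian varieties `(A, φ)` of dimension `2n` and `(B, ψ)` of dimension `2` with `φ ≫ φ = -p`,
`ψ ≫ ψ = -p`, if the strong Weil planes `weilClassesOf A φ n p ⊆ H²ⁿ(A(ℂ); ℂ)` and
`weilClassesOf B ψ 1 p ⊆ H²(B(ℂ); ℂ)` (`Literature/AlgebraicGeometry/HodgeTheory/WeilClasses`: joint
eigenclasses of all `(x·𝟙 + y·θ)^*` for the characters `(x ± iy√p)^{2m}`) consist of algebraic
classes, then so does the strong Weil plane of `(A × B, φ × ψ)` in degree `2n + 2`.

## Status: conditional

The registered stub is NOT provable from the tree as it stands: its proof needs the structure of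
`H•(A(ℂ); ℂ)` in ALL degrees (`H• = ⋀• H¹`, Mumford §1; Birkenhake–Lange 1.1.17–1.1.19), which the
tree records as the NAMED FACT `Literature.AlgebraicGeometry.Motives.abelianVarietyCohomologyExteriorH1`
(unproved; `Motives/AbelianVarietyCohomologyExteriorH1`). This file proves
`stub_surfaceProductStep_of_exteriorH1 : abelianVarietyCohomologyExteriorH1 → <stub statement>`, the
hypothesis being spelled as the VERBATIM BODY of that named fact (`∀ A, Module.Finite ℂ H¹(A(ℂ); ℂ) ∧
dim H¹(A(ℂ); ℂ) = 2 dim A ∧ HasExteriorCohomologyH1 ℂ A(ℂ)`; its module is not imported here — hub build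
backlog at the time of writing — so the theorem applies to `h : abelianVarietyCohomologyExteriorH1` by
`unfold`/definitional unfolding); nothing else is assumed.

## Proof (van Geemen LNM 1594, proof of Thm. 6.12; Schoen 1998 §10 "`W_{A×A'} ⊗ ℂ : ω_{1,σ} ∧ ⋯ ∧ ω_{6,σ}`")

Write `E±(X)` for the two Weil eigen-lines of `(X, θ)` (`weilClassesPlus/Minus`).

* Granted the fact, `E±(X)` is a LINE for every `(X, θ)` with `θ² = -p`, `dim X = 2m`
  (the tree's PROVED `finrank_weilClassesPlus/Minus_eq_one`, `weilClassesPlus/Minus_le_span_singleton`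
  of `HodgeTheory/AbelianVarietyEndomorphismsHOne`: eigenbasis of `H¹ = V₊ ⊕ V₋`, `dim V± = 2m` by the
  rationality of the trace of `θ^*`, wedge basis of `H^{2m} = ⋀^{2m} H¹`). So `E±(A × B)` is spanned by
  ANY of its non-zero elements.
* `c± := pr_A^* a± ∪ pr_B^* b±` with `0 ≠ a± ∈ E±(A)`, `0 ≠ b± ∈ E±(B)` lies in `E±(A × B)` (the
  tree's PROVED `cupProduct_map_fst_map_snd_mem_weilClassesPlus/Minus`), is ALGEBRAIC (hypotheses +
  exterior products of algebraic classes are algebraic, `cupProduct_map_fst_map_snd_mem_algebraicClasses_prod`,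
  Voisin II Prop. 9.20), and is NON-ZERO: **the exterior product of non-zero classes is non-zero**
  (`sps_cupProduct_map_fst_map_snd_ne_zero`, from the tree's PROVED bijective Künneth theorem
  `complexBetti_kunneth_bijective`, Hatcher Thm. 3.16: expand `b` in a basis of `H^j(B(ℂ))`; the
  Künneth monomorphism sends the family `(β_t · a)_t` to `pr_A^* a ∪ pr_B^* b`).
* Hence `E±(A × B) = ℂ · c± ⊆ algebraicClasses`, and `weilClassesOf = E₊ ⊔ E₋`.

No eigenvalue separation in the single operator `(𝟙 + Φ)^*` is needed (the strong planes use all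
`x·𝟙 + y·Φ`), so the hypotheses `p % 4 = 3`, `7 ≤ p` are not used; `p` prime gives `p ≥ 1`.
-/

noncomputable section
-- every declaration of this problem lives in Summit.HodgeConjecture.HodgeConjecture.… (summit = sub-problem)
set_option linter.dupNamespace false

open CategoryTheory AlgebraicGeometry MonoidalCategory
open Literature.AlgebraicGeometry

namespace Summit.HodgeConjecture.HodgeConjecture.Theorems.HeckePrymWeilLine

open Literature.AlgebraicGeometry.Motives Literature.AlgebraicGeometry.HodgeTheory
open Literature.AlgebraicTopology.SingularHomology

/-! ### Künneth: the exterior product of non-zero classes is non-zero -/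

/-- **The exterior product of non-zero classes is non-zero**: for smooth projective complex `Y`, `Z`
and `0 ≠ a ∈ Hⁱ(Y(ℂ); ℂ)`, `0 ≠ b ∈ Hʲ(Z(ℂ); ℂ)`, the class `pr_Y^* a ∪ pr_Z^* b ∈ H^{i+j}((Y × Z)(ℂ); ℂ)`
is non-zero — the uniqueness half of the Künneth theorem (Hatcher Thm. 3.16, the tree's
`complexBetti_kunneth_bijective`): expanding `b = Σ_t β_t b_t` in a basis of `Hʲ(Z(ℂ))`, the Künneth
monomorphism `(a_{q,t}) ↦ Σ pr_Y^* a_{q,t} ∪ pr_Z^* b_{q,t}` sends the family with entries `β_t · a` in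
degree `j` (zero elsewhere) to `pr_Y^* a ∪ pr_Z^* b`, and that family is non-zero.
[cite: HatcherAT2002, §3.2 Thm. 3.16] -/
theorem sps_cupProduct_map_fst_map_snd_ne_zero {m₁ m₂ : ℕ} {Y Z : SchemeOver ℂ}
    (hY : IsSmoothProjective m₁ Y) (hZ : IsSmoothProjective m₂ Z) {i j k : ℕ} (h : i + j = k)
    {a : complexBetti Y i} {b : complexBetti Z j} (ha : a ≠ 0) (hb : b ≠ 0) :
    cupProduct h (complexBetti.map (CartesianMonoidalCategory.fst Y Z) i a)
        (complexBetti.map (CartesianMonoidalCategory.snd Y Z) j b) ≠ 0 := by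
  classical
  obtain rfl : i = k - j := by omega
  -- `Hʲ(Z(ℂ)) ≠ 0` forces `j ≤ 2 m₂`
  have hj : j < 2 * m₂ + 1 := by
    by_contra hlt
    haveI := subsingleton_complexBetti hZ (k := j) (by omega)
    exact hb (Subsingleton.elim _ _)
  haveI := fun q ↦ finite_complexBetti hZ q
  -- bases of the `H^q(Z(ℂ))`, `q ≤ 2 m₂`, and the Künneth monomorphism
  let σ : Fin (2 * m₂ + 1) → Type := fun q ↦ Fin (Module.finrank ℂ (complexBetti Z q))
  let β : (q : Fin (2 * m₂ + 1)) → Module.Basis (σ q) ℂ (complexBetti Z q) :=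
    fun q ↦ Module.finBasis ℂ (complexBetti Z q)
  let d : (Σ q : Fin (2 * m₂ + 1), σ q) → ℕ := fun s ↦ (s.1 : ℕ)
  have hinj := (complexBetti_kunneth_bijective hY hZ β k).1
  -- the degree-`j` index and a non-zero coordinate of `b`
  let j' : Fin (2 * m₂ + 1) := ⟨j, hj⟩
  obtain ⟨t₀, ht₀⟩ : ∃ t, (β j').repr b t ≠ 0 := by
    by_contra! hall
    exact hb ((β j').forall_coord_eq_zero_iff.1 hall)
  have hjk : j ≤ k := by omega
  let idx : σ j' → LerayHirsch.Idx d k := fun t ↦ ⟨⟨j', t⟩, hjk⟩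
  have hidx : Function.Injective idx := fun t t' htt' ↦
    sigma_mk_injective (congrArg Subtype.val htt')
  -- the source family `F = Σ_t δ_{(j,t)} (β_t • a)` with `θ(F) = pr_Y^* a ∪ pr_Z^* b`
  let F : LerayHirsch.Src ℂ d (ComplexPoints Y) k :=
    ∑ t, Pi.single (idx t) (((β j').repr b t) • a)
  have hterm : ∀ t, LerayHirsch.lhMap ℂ d
      (AlgPoints.mapContinuous (L := ℂ) (CartesianMonoidalCategory.fst Y Z))
      (fun s ↦ complexBetti.map (CartesianMonoidalCategory.snd Y Z) (s.1 : ℕ) (β s.1 s.2)) k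
      (Pi.single (idx t) (((β j').repr b t) • a)) =
      ((β j').repr b t) •
        cupProduct h (complexBetti.map (CartesianMonoidalCategory.fst Y Z) (k - j) a)
          (complexBetti.map (CartesianMonoidalCategory.snd Y Z) j (β j' t)) := by
    intro t
    rw [LerayHirsch.lhMap_apply, Finset.sum_eq_single (⟨j', t⟩ : Σ q : Fin (2 * m₂ + 1), σ q)]
    · rw [dif_pos hjk]
      have e : (Pi.single (idx t) (((β j').repr b t) • a) : LerayHirsch.Src ℂ d (ComplexPoints Y) k)
          (idx t) = ((β j').repr b t) • a := Pi.single_eq_same _ _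
      change cupProduct h (complexBetti.map (CartesianMonoidalCategory.fst Y Z) (k - j)
        ((Pi.single (idx t) (((β j').repr b t) • a) : LerayHirsch.Src ℂ d (ComplexPoints Y) k)
          (idx t))) (complexBetti.map (CartesianMonoidalCategory.snd Y Z) j (β j' t)) = _
      rw [e, map_smul, LinearMap.map_smul₂]
    · intro s _ hs
      by_cases hle : d s ≤ k
      · rw [dif_pos hle]
        have hne : (⟨s, hle⟩ : LerayHirsch.Idx d k) ≠ idx t := fun e ↦ hs (congrArg Subtype.val e)
        rw [Pi.single_eq_of_ne hne, map_zero, LinearMap.map_zero₂]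
      · rw [dif_neg hle]
    · intro hn
      exact absurd (Finset.mem_univ _) hn
  have hF : LerayHirsch.lhMap ℂ d
      (AlgPoints.mapContinuous (L := ℂ) (CartesianMonoidalCategory.fst Y Z))
      (fun s ↦ complexBetti.map (CartesianMonoidalCategory.snd Y Z) (s.1 : ℕ) (β s.1 s.2)) k F =
      cupProduct h (complexBetti.map (CartesianMonoidalCategory.fst Y Z) (k - j) a)
        (complexBetti.map (CartesianMonoidalCategory.snd Y Z) j b) := by
    have hb' : b = ∑ t, ((β j').repr b t) • β j' t := ((β j').sum_repr b).symm
    conv_rhs => rw [hb', map_sum, map_sum]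
    rw [map_sum]
    refine Finset.sum_congr rfl fun t _ ↦ ?_
    rw [hterm t, map_smul, map_smul]
  -- if the exterior product vanished, `F = 0`, hence `β_{t₀} • a = 0`: absurd
  intro h0
  have hF0 : F = 0 := hinj (by rw [hF, h0, map_zero])
  have hFt : F (idx t₀) = ((β j').repr b t₀) • a := by
    change (∑ t, Pi.single (idx t) (((β j').repr b t) • a) :
      LerayHirsch.Src ℂ d (ComplexPoints Y) k) (idx t₀) = _
    rw [Finset.sum_apply, Finset.sum_eq_single t₀, Pi.single_eq_same]
    · intro t _ ht
      exact Pi.single_eq_of_ne (hidx.ne (Ne.symm ht)) _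
    · intro hn
      exact absurd (Finset.mem_univ _) hn
  rw [hF0, Pi.zero_apply] at hFt
  rcases smul_eq_zero.mp hFt.symm with h1 | h1
  · exact ht₀ h1
  · exact ha h1

/-- **The exterior product of non-zero classes on a product of abelian varieties is non-zero**
(`sps_cupProduct_map_fst_map_snd_ne_zero` retyped over `A.prod B` with the projections
`AbelianVariety.fst/snd`; abelian varieties are smooth projective). [cite: HatcherAT2002, §3.2 Thm. 3.16] -/
theorem sps_cupProduct_map_fst_map_snd_ne_zero_prod {A B : AbelianVariety ℂ} {m₁ m₂ : ℕ}
    (hA : IsSmoothProjective m₁ A.X) (hB : IsSmoothProjective m₂ B.X) {i j k : ℕ} (h : i + j = k)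
    {a : complexBetti A.X i} {b : complexBetti B.X j} (ha : a ≠ 0) (hb : b ≠ 0) :
    cupProduct h (complexBetti.map (AbelianVariety.fst A B).hom.hom.hom i a)
        (complexBetti.map (AbelianVariety.snd A B).hom.hom.hom j b) ≠ 0 :=
  sps_cupProduct_map_fst_map_snd_ne_zero hA hB h ha hb

/-! ### Bookkeeping -/

/-- An abelian variety of dimension `d` is smooth projective of dimension `d`
(`AbelianVariety.isSmoothProjective_holds`). [cite: Hartshorne1977, II Thm. 8.15 and III Thm. 10.2] -/
theorem sps_isSmoothProjective_of_dim_eq (C : AbelianVariety ℂ) {d : ℕ} (hC : C.dim = d) :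
    IsSmoothProjective d C.X := by
  have h := (AbelianVariety.isSmoothProjective_holds (A := C))
  rw [AbelianVariety.isSmoothProjective, hC] at h
  exact h

/-- A subspace of dimension `1` contains a non-zero vector. [folklore] -/
theorem sps_exists_ne_zero_of_finrank_eq_one {M : Type*} [AddCommGroup M] [Module ℂ M]
    {E : Submodule ℂ M} (hE : Module.finrank ℂ E = 1) : ∃ c ∈ E, c ≠ 0 := by
  refine Submodule.exists_mem_ne_zero_of_ne_bot fun h ↦ ?_
  rw [h, finrank_bot] at hE
  exact zero_ne_one hE

/-! ### The product step, conditional on `H•(A(ℂ)) = ⋀• H¹` -/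

/-- **One line of the product step**: if a line `E ⊆ H^{2(n+1)}((A × B)(ℂ))` is spanned by every
non-zero element it contains, and contains the exterior product `pr_A^* a₀ ∪ pr_B^* b₀` of NON-ZERO
ALGEBRAIC classes `a₀ ∈ N^n H^{2n}(A(ℂ))`, `b₀ ∈ N¹ H²(B(ℂ))`, then `E` consists of algebraic classes
(Künneth non-vanishing + exterior products of algebraic classes are algebraic, Voisin II Prop. 9.20).
[cite: VoisinHodgeII2003, proof of Prop. 9.20 (first display)] [cite: HatcherAT2002, §3.2 Thm. 3.16] -/
theorem sps_line_le_algebraicClasses {A B : AbelianVariety ℂ} {n : ℕ}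
    (hA : IsSmoothProjective (2 * n) A.X) (hB : IsSmoothProjective (2 * 1) B.X)
    {E : Submodule ℂ (complexBetti (A.prod B).X (2 * (n + 1)))}
    (hE : ∀ c ∈ E, c ≠ 0 → E ≤ ℂ ∙ c)
    {a₀ : complexBetti A.X (2 * n)} {b₀ : complexBetti B.X (2 * 1)}
    (ha₀ : a₀ ∈ algebraicClasses A.X n) (hb₀ : b₀ ∈ algebraicClasses B.X 1) (ha0 : a₀ ≠ 0)
    (hb0 : b₀ ≠ 0)
    (hmem : cupProduct (two_mul_add_two_mul n 1)
        (complexBetti.map (AbelianVariety.fst A B).hom.hom.hom (2 * n) a₀)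
        (complexBetti.map (AbelianVariety.snd A B).hom.hom.hom (2 * 1) b₀) ∈ E) :
    E ≤ algebraicClasses (A.prod B).X (n + 1) := by
  refine (hE _ hmem (sps_cupProduct_map_fst_map_snd_ne_zero_prod hA hB _ ha0 hb0)).trans ?_
  rw [Submodule.span_singleton_le_iff_mem]
  exact cupProduct_map_fst_map_snd_mem_algebraicClasses_prod hA hB ha₀ hb₀

/-- **Stub A2 conditional on the named fact `Motives.abelianVarietyCohomologyExteriorH1`**
(`H•(X(ℂ); ℂ) = ⋀• H¹(X(ℂ); ℂ)` with `b₁ = 2 dim X` for complex abelian varieties; Mumford §1,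
Birkenhake–Lange 1.1.17–1.1.19; the hypothesis `hΛ` is the verbatim body of that `def … : Prop`):
ONE PRODUCT STEP of the anchor — algebraic strong Weil planes of
`(A, φ)` (degree `2n`) and of the Weil surface `(B, ψ)` give an algebraic strong Weil plane of
`(A × B, φ × ψ)` in degree `2n + 2`. Granted the fact, each Weil eigen-line `E±` of `A`, `B`, `A × B`
is a line (`finrank_weilClassesPlus/Minus_eq_one`), spanned by any non-zero element
(`weilClassesPlus/Minus_le_span_singleton`); the exterior product of non-zero generators of `E±(A)`,
`E±(B)` is a non-zero (`sps_cupProduct_map_fst_map_snd_ne_zero`, Künneth), algebraic (hypotheses and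
`cupProduct_map_fst_map_snd_mem_algebraicClasses_prod`) element of `E±(A × B)`
(`cupProduct_map_fst_map_snd_mem_weilClassesPlus/Minus`), hence spans it: "`⋀^{2n}W` and `⋀^{2n}W^*`
… span `(⋀^{2n}_K H¹(X, ℚ)) ⊗ ℂ`" for the product is the product of those for the factors.
[cite: vanGeemen1994HodgeAV, proof of Thm. 6.12] [cite: Schoen1998HodgeWeilAddendum, §10 (proof of the Proposition)] -/
theorem stub_surfaceProductStep_of_exteriorH1 :
    (∀ A : AbelianVariety ℂ,
      Module.Finite ℂ (complexBetti A.X 1) ∧ Module.finrank ℂ (complexBetti A.X 1) = 2 * A.dim ∧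
        HasExteriorCohomologyH1 ℂ (ComplexPoints A.X)) →
    ∀ p : ℕ, p.Prime → p % 4 = 3 → 7 ≤ p → ∀ (n : ℕ) (A : AbelianVariety ℂ) (φ : A ⟶ A)
      (B : AbelianVariety ℂ) (ψ : B ⟶ B),
      A.dim = 2 * n → B.dim = 2 → φ ≫ φ = -((p : ℤ) • 𝟙 A) → ψ ≫ ψ = -((p : ℤ) • 𝟙 B) →
      weilClassesOf A φ n p ≤ algebraicClasses A.X n →
      weilClassesOf B ψ 1 p ≤ algebraicClasses B.X 1 →
        weilClassesOf (A.prod B)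
            (AbelianVariety.prodLift (AbelianVariety.fst A B ≫ φ) (AbelianVariety.snd A B ≫ ψ))
            (n + 1) p ≤
          algebraicClasses (A.prod B).X (n + 1) := by
  intro hΛ p hp _ _ n A φ B ψ hA hB hφ hψ hAalg hBalg
  have hp0 : 0 < p := hp.pos
  have hφ' : φ ≫ φ = -(p • 𝟙 A) := by rw [hφ, natCast_zsmul]
  have hψ' : ψ ≫ ψ = -(p • 𝟙 B) := by rw [hψ, natCast_zsmul]
  have hB1 : B.dim = 2 * 1 := hB
  set Φ := AbelianVariety.prodLift (AbelianVariety.fst A B ≫ φ) (AbelianVariety.snd A B ≫ ψ)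
  have hΦ : Φ ≫ Φ = -(p • 𝟙 (A.prod B)) := prodLift_comp_self_eq_neg_nsmul hφ' hψ'
  have h₁ : Φ ≫ AbelianVariety.fst A B = AbelianVariety.fst A B ≫ φ :=
    AbelianVariety.prodLift_fst _ _
  have h₂ : Φ ≫ AbelianVariety.snd A B = AbelianVariety.snd A B ≫ ψ :=
    AbelianVariety.prodLift_snd _ _
  have hAsp : IsSmoothProjective (2 * n) A.X := sps_isSmoothProjective_of_dim_eq A hA
  have hBsp : IsSmoothProjective (2 * 1) B.X := sps_isSmoothProjective_of_dim_eq B hB1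
  -- `b₁ = 2 dim` for `A`, `B`, `A × B` (the fact)
  have hbA : Module.finrank ℂ (complexBetti A.X 1) = 2 * (2 * n) := by rw [(hΛ A).2.1, hA]
  have hbB : Module.finrank ℂ (complexBetti B.X 1) = 2 * (2 * 1) := by rw [(hΛ B).2.1, hB1]
  have hbC : Module.finrank ℂ (complexBetti (A.prod B).X 1) = 2 * (2 * (n + 1)) := by
    rw [(hΛ (A.prod B)).2.1, dim_prod_eq_two_mul hA hB1]
  -- the two lines of the product
  rw [weilClassesOf]
  refine sup_le ?_ ?_
  · obtain ⟨a₀, ha₀, ha0⟩ := sps_exists_ne_zero_of_finrank_eq_one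
      (finrank_weilClassesPlus_eq_one (hΛ A).2.2 hbA hp0 hφ')
    obtain ⟨b₀, hb₀, hb0⟩ := sps_exists_ne_zero_of_finrank_eq_one
      (finrank_weilClassesPlus_eq_one (hΛ B).2.2 hbB hp0 hψ')
    exact sps_line_le_algebraicClasses hAsp hBsp
      (fun c hc hc0 ↦ weilClassesPlus_le_span_singleton (hΛ (A.prod B)).2.2
        hbC hp0 hΦ hc hc0)
      (hAalg (weilClassesPlus_le_weilClassesOf A φ n p ha₀))
      (hBalg (weilClassesPlus_le_weilClassesOf B ψ 1 p hb₀)) ha0 hb0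
      (cupProduct_map_fst_map_snd_mem_weilClassesPlus h₁ h₂ ha₀ hb₀)
  · obtain ⟨a₀, ha₀, ha0⟩ := sps_exists_ne_zero_of_finrank_eq_one
      (finrank_weilClassesMinus_eq_one (hΛ A).2.2 hbA hp0 hφ')
    obtain ⟨b₀, hb₀, hb0⟩ := sps_exists_ne_zero_of_finrank_eq_one
      (finrank_weilClassesMinus_eq_one (hΛ B).2.2 hbB hp0 hψ')
    exact sps_line_le_algebraicClasses hAsp hBsp
      (fun c hc hc0 ↦ weilClassesMinus_le_span_singleton (hΛ (A.prod B)).2.2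
        hbC hp0 hΦ hc hc0)
      (hAalg (weilClassesMinus_le_weilClassesOf A φ n p ha₀))
      (hBalg (weilClassesMinus_le_weilClassesOf B ψ 1 p hb₀)) ha0 hb0
      (cupProduct_map_fst_map_snd_mem_weilClassesMinus h₁ h₂ ha₀ hb₀)

end Summit.HodgeConjecture.HodgeConjecture.Theorems.HeckePrymWeilLine

end
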